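import Summits.BirchSwinnertonDyer.BirchSwinnertonDyer.Theorems.GenusKolyvaginAtTwoGenusPrimitiveSupplyAtTwoPosDiscShallowKFourPosBTwoSharpIff
import Literature.NumberTheory.EllipticCurves.SecondDescentShaExponentProofs
import Literature.NumberTheory.EllipticCurves.BSDSelmerCMPConverseRankOneProofs
import Literature.NumberTheory.EllipticCurves.NonEisensteinPrimeOfSurjective
import HarnessLib

/-!
# Route `GenusKolyvaginAtTwo`, crux K₄⁺ `K4Pos` (stmt-BirchSwinnertonDyer-31469) — THE SELMER-COUNT CURRENCY OF K₄⁺: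
# on the Δ>0 cut, modulo Q2 and GZK, «K4Pos's conclusion» ⟺ `#Sel_(2^M₀)(E/ℚ) ≠ #Sel_(2^(M₀−1))(E/ℚ)`,
# and `#Ш(E/ℚ)[2^∞] = #Sel_(2^M₀)(E/ℚ)` there (sequel `…KFourPosSelmerCountExact`: ⟺ `#Sel_(2^M₀)(E/ℚ) = 4^(M₀)`)

Width seat `bsd-line-gk2-p5` g37 (cell `bsd-f1-sign2`), `--supports stmt-BirchSwinnertonDyer-31469 --as helper`.  THEOREMS ONLY (no definition,
no named fact, no `sorry`); standard axioms.  **BSD is NOT proved by this file; K4Pos is NOT proved; nothing is closed.**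

WHY.  LEAD-BRIEF-g23-ADDENDUM B.3 priced K₄⁺ as «`#Ш(E/ℚ)[2^∞] = 4^(M₀)`» (kernel form: gk2-p4 g29 `ShaCores.kFourPos_shape_of_natCard_shaPrimary_rat_eq_pow`,
g36 `kFourPos_shape_iff_exists_mem_sha_two_pow_pred_smul_ne_zero`).  `Ш` is not what descent software returns; SELMER COUNTS are.  On K4Pos's
frame `E(ℚ)` is finite (`r_an = 0` + GZK) with `E(ℚ)[2] = 0` (`ρ̄_{E,2}` onto), so the exact descent count (AEC X.4.2)
`#Sel_(n)(E/ℚ) = n^rk · #E(ℚ)[n] · #Ш(E/ℚ)[n]` collapses to `#Sel_(2^m)(E/ℚ) = #Ш(E/ℚ)[2^m]` for EVERY `m` (§1), and Kolyvagin's B₂ over `ℚ`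
(`two_pow_M0_smul_eq_zero_of_mem_sha_rat_signFree`, mod Q2: `2^(M₀) · Ш(E/ℚ)[2^∞] = 0`) makes `Ш(E/ℚ)[2^∞] = Ш(E/ℚ)[2^(M₀)]` FINITE with
`#Ш(E/ℚ)[2^∞] = #Sel_(2^M₀)(E/ℚ)` (§2).  Hence, on the cut frame, modulo Q2 (`KolyvaginRelationAtTwo`) and GZK (`MultPublishedInputsAtTwo`):
* §2 ★ `kFourPos_shape_iff_natCard_selmerGroup_ne` — **K4Pos's conclusion ⟺ `#Sel_(2^M₀)(E/ℚ) ≠ #Sel_(2^(M₀−1))(E/ℚ)`** (the `2^(M₀)`-descent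
  over `ℚ` sees STRICTLY more than the `2^(M₀−1)`-descent) — no structure theorem, no pairing, no bound on `#Sel₂`; depth two (`M₀ = 2`, the
  `#Sel₂(E) = 4` cell): **K4Pos ⟺ `#Sel₄(E/ℚ) ≠ 4`** (`kFourPos_shape_iff_natCard_selmerGroup_four_ne_four_of_depth_two`).
* §2 `natCard_shaPrimary_rat_eq_natCard_selmerGroup_two_pow` — **`#Ш(E/ℚ)[2^∞] = #Sel_(2^M₀)(E/ℚ)`** (and `= #Sel_(2^m)(E/ℚ)` for every
  `m ≥ M₀`): the Ш-cardinality currency of B.3 IS one descent count.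
* (sequel `…KFourPosSelmerCountExact`) ★★ K4Pos's conclusion ⟺ `#Sel_(2^M₀)(E/ℚ) = 4^(M₀)` on the `#Sel₂(E) = 4` cell, and the ℚ-side one-block
  structure `Ш(E/ℚ)[2^∞] ≃ (ℤ/2^e)²`, `1 ≤ e ≤ M₀`, read from Selmer counts alone.
INSTRUMENT (for `-data` / the pen): the per-curve K₄⁺ test at depth `M₀` is ONE `2^(M₀)`-descent count over `ℚ` — no BSD, no `Ш_an`, no Heegner
point beyond `M₀` itself; BSD predicts `#Sel_(2^M₀)(E/ℚ) = 4^(M₀)` on every K₄⁺ census cell.  Class-wide this is the `2`-part of BSD in rank `0`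
given the Gross–Zagier index: OPEN.  BSD is NOT proved by any of this.

References: [SilvermanAEC2009] Thm. X.4.2; [Kolyvagin1989Izv] Thm. B₂; [McCallumLMS1991] §5 Thm. 5.4, Cor. 5.6; [Mazur1977] Ch. III §5.
-/

set_option autoImplicit false
-- the Theorems namespace of this sub repeats the summit name by design (D-0017 nested layout)
set_option linter.dupNamespace false

noncomputable section

open scoped Classical
open scoped AddSubgroup

namespace Summit.BirchSwinnertonDyer.BirchSwinnertonDyer.Theorems.GenusExact.PlusDescent

open WeierstrassCurve NumberField IsDedekindDomain Field Literature.NumberTheory.EllipticCurves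
  Literature.NumberTheory.GaloisRepresentations Literature.NumberTheory.EllipticCurves.ModularForms AddSubgroup
  Literature.NumberTheory.EllipticCurves.RingClassField
open Summit.BirchSwinnertonDyer.BirchSwinnertonDyer.Theses.GenusKolyvaginAtTwo (KolyvaginRelationAtTwo MultPublishedInputsAtTwo)

universe u

/-! ## §1 Descent-count algebra: `#Sel_(2^m)(E/F) = #Ш(E/F)[2^m]` when `rank E(F) = 0` and `E(F)[2] = 0` (any number field) -/

section Descent

variable {F : Type u} [Field F] [NumberField F] (V : WeierstrassCurve F) [V.IsElliptic]

omit [NumberField F] [V.IsElliptic] in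
/-- **`#E(F)[2^m] = 1` when `E(F)[2] = 0`** (no `2`-torsion ⟹ no `2^m`-torsion, `PlusDescent.eq_zero_of_two_pow_zsmul_eq_zero`). [folklore] -/
theorem natCard_torsionBy_point_two_pow_eq_one (h2 : ∀ P : V.toAffine.Point, (2 : ℤ) • P = 0 → P = 0) (m : ℕ) :
    Nat.card (V.toAffine.Point[((2 ^ m : ℕ) : ℤ)]) = 1 := by
  have hbot : V.toAffine.Point[((2 ^ m : ℕ) : ℤ)] = ⊥ := by
    rw [eq_bot_iff]
    intro P hP
    rw [AddSubgroup.mem_bot]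
    exact eq_zero_of_two_pow_zsmul_eq_zero h2 m ((Submodule.mem_torsionBy_iff _ _).mp hP)
  rw [hbot, AddSubgroup.card_bot]

omit [NumberField F] [V.IsElliptic] in
/-- `#E(F)[2] = 1 ⟹ E(F)[2] = 0` (the form in which the tree states «no rational `2`-torsion»). [folklore] -/
theorem forall_eq_zero_of_two_zsmul_eq_zero_of_natCard_torsionBy_two_eq_one (h1 : Nat.card (V.toAffine.Point[((2 : ℕ) : ℤ)]) = 1) :
    ∀ P : V.toAffine.Point, (2 : ℤ) • P = 0 → P = 0 := by
  haveI := (Nat.card_eq_one_iff_unique.mp h1).1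
  intro P hP
  have hmem : P ∈ V.toAffine.Point[((2 : ℕ) : ℤ)] := by
    rw [Submodule.mem_toAddSubgroup, Submodule.mem_torsionBy_iff, Nat.cast_ofNat]
    exact hP
  have h0 : (⟨P, hmem⟩ : V.toAffine.Point[((2 : ℕ) : ℤ)]) = ⟨0, AddSubgroup.zero_mem _⟩ := Subsingleton.elim _ _
  exact congrArg Subtype.val h0

/-- **`#Sel_(2^m)(E/F) = #Ш(E/F)[2^m]`** for an elliptic curve over a number field with `rank E(F) = 0` and `E(F)[2] = 0`: the exact
descent count `#Sel_(n) = n^rk · #E(F)[n] · #Ш[n]` (AEC X.4.2 (a), tree `pow_mordellWeilRank_mul_natCard_torsionBy_mul_natCard_shaTorsionBy_eq`)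
with `rk = 0` and `#E(F)[2^m] = 1`. [cite: SilvermanAEC2009, Thm. X.4.2 (a), (b)] -/
theorem natCard_selmerGroup_two_pow_eq_natCard_shaTorsionBy (hrk : V.mordellWeilRank = 0)
    (h2 : ∀ P : V.toAffine.Point, (2 : ℤ) • P = 0 → P = 0) (m : ℕ) :
    Nat.card (selmerGroup V ((2 ^ m : ℕ) : ℤ)) = Nat.card ((V.sha)[((2 ^ m : ℕ) : ℤ)]) := by
  have h := V.pow_mordellWeilRank_mul_natCard_torsionBy_mul_natCard_shaTorsionBy_eq (n := 2 ^ m) (pow_ne_zero m two_ne_zero)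
  rw [hrk, pow_zero, one_mul, natCard_torsionBy_point_two_pow_eq_one V h2 m, one_mul] at h
  exact h.symm

omit [V.IsElliptic] in
/-- `Ш(E/F)[2^m] = Ш(E/F)[2^∞]` (as subgroups of `Ш(E/F)`) as soon as `2^(M₀) · Ш(E/F)[2^∞] = 0` and `M₀ ≤ m`. [folklore] -/
theorem shaTorsionBy_two_pow_eq_primaryComponent_of_exponent {M₀ m : ℕ} (hm : M₀ ≤ m)
    (hexp : ∀ a ∈ AddCommGroup.primaryComponent (↥V.sha) 2, 2 ^ M₀ • a = 0) :
    (V.sha)[((2 ^ m : ℕ) : ℤ)] = AddCommGroup.primaryComponent (↥V.sha) 2 := by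
  ext a
  rw [torsionBy.nsmul_iff, AddCommGroup.mem_primaryComponent]
  constructor
  · intro h
    exact ⟨m, h⟩
  · intro h
    have h0 := hexp a (AddCommGroup.mem_primaryComponent.mpr h)
    obtain ⟨j, rfl⟩ := Nat.exists_eq_add_of_le hm
    rw [pow_add, mul_nsmul, h0, nsmul_zero]

omit [V.IsElliptic] in
/-- The same, as cardinalities: `#Ш(E/F)[2^m] = #Ш(E/F)[2^∞]` for `m ≥ M₀` when `2^(M₀) · Ш(E/F)[2^∞] = 0`. [folklore] -/
theorem natCard_shaTorsionBy_two_pow_eq_natCard_primaryComponent_of_exponent {M₀ m : ℕ} (hm : M₀ ≤ m)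
    (hexp : ∀ a ∈ AddCommGroup.primaryComponent (↥V.sha) 2, 2 ^ M₀ • a = 0) :
    Nat.card ((V.sha)[((2 ^ m : ℕ) : ℤ)]) = Nat.card (AddCommGroup.primaryComponent (↥V.sha) 2) := by
  rw [shaTorsionBy_two_pow_eq_primaryComponent_of_exponent V hm hexp]

/-- **`Ш(E/F)[2^∞]` is FINITE when it has finite exponent**: `2^(M₀) · Ш(E/F)[2^∞] = 0` ⟹ `Ш(E/F)[2^∞] = Ш(E/F)[2^(M₀)]`, finite by
AEC X.4.2 (b) (`finite_sha_torsionBy_holds`). [cite: SilvermanAEC2009, Thm. X.4.2 (b)] -/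
theorem finite_primaryComponent_sha_of_exponent {M₀ : ℕ} (hexp : ∀ a ∈ AddCommGroup.primaryComponent (↥V.sha) 2, 2 ^ M₀ • a = 0) :
    Finite (AddCommGroup.primaryComponent (↥V.sha) 2) := by
  haveI : Finite ((V.sha)[((2 ^ M₀ : ℕ) : ℤ)]) := V.finite_sha_torsionBy_holds _ (by positivity)
  rw [← shaTorsionBy_two_pow_eq_primaryComponent_of_exponent V le_rfl hexp]
  infer_instance

/-- **`#Sel_(2^m)(E/F) = #Ш(E/F)[2^∞]` for every `m ≥ M₀`** when `rank E(F) = 0`, `E(F)[2] = 0` and `2^(M₀) · Ш(E/F)[2^∞] = 0`.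
[cite: SilvermanAEC2009, Thm. X.4.2 (a), (b)] -/
theorem natCard_selmerGroup_two_pow_eq_natCard_primaryComponent (hrk : V.mordellWeilRank = 0)
    (h2 : ∀ P : V.toAffine.Point, (2 : ℤ) • P = 0 → P = 0) {M₀ m : ℕ} (hm : M₀ ≤ m)
    (hexp : ∀ a ∈ AddCommGroup.primaryComponent (↥V.sha) 2, 2 ^ M₀ • a = 0) :
    Nat.card (selmerGroup V ((2 ^ m : ℕ) : ℤ)) = Nat.card (AddCommGroup.primaryComponent (↥V.sha) 2) := by
  rw [natCard_selmerGroup_two_pow_eq_natCard_shaTorsionBy V hrk h2 m, natCard_shaTorsionBy_two_pow_eq_natCard_primaryComponent_of_exponent V hm hexp]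

/-- **A class of `Ш(E/F)` of order divisible by `2^(M₀)` among the `2^(M₀)`-torsion ⟺ `#Sel_(2^M₀)(E/F) ≠ #Sel_(2^(M₀−1))(E/F)`** (`rank E(F) = 0`,
`E(F)[2] = 0`, `M₀ ≥ 1`): both Selmer counts are `#Ш[2^(M₀)]`, `#Ш[2^(M₀−1)]` (§1), and `Ш[2^(M₀−1)] ≤ Ш[2^(M₀)]` are finite subgroups — equal iff of
the same order. [cite: SilvermanAEC2009, Thm. X.4.2 (a), (b)] -/
theorem exists_mem_sha_two_pow_smul_ne_zero_iff_natCard_selmerGroup_ne (hrk : V.mordellWeilRank = 0)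
    (h2 : ∀ P : V.toAffine.Point, (2 : ℤ) • P = 0 → P = 0) {M₀ : ℕ} (hM₀ : 1 ≤ M₀) :
    (∃ a : V.galH1, a ∈ V.sha ∧ ((2 ^ M₀ : ℕ) : ℤ) • a = 0 ∧ ((2 ^ (M₀ - 1) : ℕ) : ℤ) • a ≠ 0) ↔
      Nat.card (selmerGroup V ((2 ^ M₀ : ℕ) : ℤ)) ≠ Nat.card (selmerGroup V ((2 ^ (M₀ - 1) : ℕ) : ℤ)) := by
  rw [natCard_selmerGroup_two_pow_eq_natCard_shaTorsionBy V hrk h2 M₀, natCard_selmerGroup_two_pow_eq_natCard_shaTorsionBy V hrk h2 (M₀ - 1)]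
  haveI hfin : Finite ((V.sha)[((2 ^ M₀ : ℕ) : ℤ)]) := V.finite_sha_torsionBy_holds _ (by positivity)
  -- `Ш[2^(M₀−1)] ≤ Ш[2^(M₀)]`
  have hle : (V.sha)[((2 ^ (M₀ - 1) : ℕ) : ℤ)] ≤ (V.sha)[((2 ^ M₀ : ℕ) : ℤ)] := by
    intro a ha
    rw [torsionBy.nsmul_iff] at ha ⊢
    rw [← Nat.sub_add_cancel hM₀, pow_succ, mul_nsmul, ha, nsmul_zero]
  constructor
  · rintro ⟨a, ha, hka, hne⟩ heq
    -- equal orders and `≤` force equality of the two torsion subgroups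
    have hfin' : Finite ((V.sha)[((2 ^ (M₀ - 1) : ℕ) : ℤ)]) := Finite.of_injective _ (AddSubgroup.inclusion_injective hle)
    have heq' : (V.sha)[((2 ^ (M₀ - 1) : ℕ) : ℤ)] = (V.sha)[((2 ^ M₀ : ℕ) : ℤ)] :=
      AddSubgroup.eq_of_le_of_card_ge hle (by rw [heq])
    have hmem : (⟨a, ha⟩ : ↥V.sha) ∈ (V.sha)[((2 ^ M₀ : ℕ) : ℤ)] := by
      rw [torsionBy.nsmul_iff]
      exact Subtype.ext (by rw [AddSubgroupClass.coe_nsmul, ZeroMemClass.coe_zero, ← natCast_zsmul]; exact hka)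
    rw [← heq', torsionBy.nsmul_iff] at hmem
    apply hne
    have h := congrArg Subtype.val hmem
    rw [AddSubgroupClass.coe_nsmul, ZeroMemClass.coe_zero, ← natCast_zsmul] at h
    exact h
  · intro hne
    by_contra hno
    push Not at hno
    apply hne
    -- every `2^(M₀)`-torsion class is killed by `2^(M₀−1)`: the two subgroups coincide
    have hge : (V.sha)[((2 ^ M₀ : ℕ) : ℤ)] ≤ (V.sha)[((2 ^ (M₀ - 1) : ℕ) : ℤ)] := by
      intro a ha
      rw [torsionBy.nsmul_iff] at ha ⊢
      have hka : ((2 ^ M₀ : ℕ) : ℤ) • (a : V.galH1) = 0 := by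
        rw [natCast_zsmul, ← AddSubgroupClass.coe_nsmul, ha, ZeroMemClass.coe_zero]
      have h := hno a a.2 hka
      exact Subtype.ext (by rw [AddSubgroupClass.coe_nsmul, ZeroMemClass.coe_zero, ← natCast_zsmul]; exact h)
    rw [le_antisymm hge hle]

end Descent

/-! ## §2 On K4Pos's cut frame: `#Ш(E/ℚ)[2^∞] = #Sel_(2^M₀)(E/ℚ)`, and ★ K4Pos ⟺ `#Sel_(2^M₀)(E/ℚ) ≠ #Sel_(2^(M₀−1))(E/ℚ)` -/

section Frame

/-- `ρ̄_{E,2}` onto ⟹ `#E(ℚ)[2] = 1` (Mazur: an irreducible `E[2]` has no rational line; tree `natCard_torsionBy_eq_one_of_hasIrreducibleModPGaloisRep`).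
[cite: Mazur1977, Ch. III §5, p. 157] -/
theorem natCard_torsionBy_point_two_eq_one_of_hasSurjectiveModNGaloisRep_two (W : WeierstrassCurve ℚ) [W.IsElliptic]
    (hs2 : W.HasSurjectiveModNGaloisRep 2) : Nat.card (AddSubgroup.torsionBy W.toAffine.Point ((2 : ℕ) : ℤ)) = 1 := by
  haveI : Fact (Nat.Prime 2) := ⟨Nat.prime_two⟩
  haveI : NeZero ((2 : ℕ) : ℚ) := ⟨by norm_num⟩
  exact natCard_torsionBy_eq_one_of_hasIrreducibleModPGaloisRep W 2
    (hasIrreducibleModPGaloisRep_of_hasSurjectiveModNGaloisRep W 2 (by simpa using hs2))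

/-- **`#Ш(E/ℚ)[2^∞] = #Sel_(2^m)(E/ℚ)` for every `m ≥ M₀`, and `Ш(E/ℚ)[2^∞]` is finite**, on K4Pos's cut frame modulo Q2 and GZK: non-CM
`E/ℚ` globally minimal with `r_an = 0` (so `w(E) = +1` and, by GZK, `rank E(ℚ) = 0`), `ρ_{E,2^n}` onto (so `E(ℚ)[2] = 0`), odd Tamagawa
product, an odd multiplicative prime `v`; `K` imaginary quadratic, `d_K` odd `≠ −3`, Heegner, the two Theorem-B₂ non-squares; `d₁` with
`2^(M₀+1) ∤ P(1)`.  B₂ over `ℚ` (`two_pow_M0_smul_eq_zero_of_mem_sha_rat_signFree`) gives `2^(M₀) · Ш(E/ℚ)[2^∞] = 0`, then §1.  The sign of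
`Δ` and the twin are NOT used. BSD is NOT proved by this. [cite: Kolyvagin1989Izv, Thm. B₂] [cite: SilvermanAEC2009, Thm. X.4.2 (a), (b)] -/
theorem natCard_shaPrimary_rat_eq_natCard_selmerGroup_two_pow (hQ2 : KolyvaginRelationAtTwo) (hGZK : MultPublishedInputsAtTwo)
    (W : WeierstrassCurve ℚ) [W.IsElliptic] [W.IsGloballyMinimal] [NeZero (W.conductorNorm ℤ)] (hcm : ¬ W.HasCM) (hr0 : W.analyticRank = 0)
    (hρ : ∀ n : ℕ, 0 < n → W.HasSurjectiveModNGaloisRep ((2 : ℤ) ^ n)) (hT : Odd W.tamagawaProduct)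
    (v : HeightOneSpectrum (𝓞 ℚ)) (h2v : ((2 : ℕ) : 𝓞 ℚ) ∉ v.asIdeal) (hNv : ((W.conductorNorm ℤ : ℕ) : 𝓞 ℚ) ∈ v.asIdeal)
    (hmult : W.HasMultiplicativeReductionAt v)
    (K : Type) [Field K] [NumberField K] (hIQ : IsImaginaryQuadratic K) (hodd : Odd (NumberField.discr K))
    (h3 : NumberField.discr K ≠ -3) (hHe : SatisfiesHeegnerHypothesis (W.conductorNorm ℤ) K)
    (hsq1 : ¬ IsSquare ((NumberField.discr K : ℚ) * -|W.Δ|)) (hsq2 : ¬ IsSquare ((NumberField.discr K : ℚ) * (-(2 * |W.Δ|))))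
    (Dt : ModularParametrizationData W (W.conductorNorm ℤ)) (β : ℤ) (ι : K →+* ℂ) (d₁ : KolyvaginHeegnerData Dt β ι 1) (M₀ : ℕ)
    (hndiv : ¬ ∃ Q : (W.baseChange (ringClassField K ι 1)).toAffine.Point, ((2 ^ (M₀ + 1) : ℕ) : ℤ) • Q = d₁.derivedPoint)
    {m : ℕ} (hm : M₀ ≤ m) :
    Finite (AddCommGroup.primaryComponent (↥W.sha) 2) ∧
      Nat.card (AddCommGroup.primaryComponent (↥W.sha) 2) = Nat.card (W.selmerGroup ((2 ^ m : ℕ) : ℤ)) := by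
  have hs2 : W.HasSurjectiveModNGaloisRep 2 := by simpa using hρ 1 one_pos
  have hw : W.rootNumber = 1 :=
    (Literature.Barriers.BirchSwinnertonDyer.even_analyticRank_iff_of_isNewformOf_conductorLevel Dt.isNewformOf).mp
      (by rw [hr0]; exact Even.zero)
  have hrk0 : W.mordellWeilRank = 0 := by rw [(hGZK W (by rw [hr0]; exact zero_le_one)).1, hr0]
  -- `E(ℚ)[2] = 0` (`convert` bridges the decidable-equality instance on `E(ℚ)` used by the general-`F` lemmas of §1)
  have h2t := forall_eq_zero_of_two_zsmul_eq_zero_of_natCard_torsionBy_two_eq_one W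
    (by convert natCard_torsionBy_point_two_eq_one_of_hasSurjectiveModNGaloisRep_two W hs2)
  -- B₂ over `ℚ`: `2^(M₀)` kills `Ш(E/ℚ)[2^∞]`
  have hexp : ∀ a ∈ AddCommGroup.primaryComponent (↥W.sha) 2, 2 ^ M₀ • a = 0 := by
    intro a ha
    obtain ⟨k, hk⟩ := (AddCommGroup.mem_primaryComponent).mp ha
    have hka : ((2 ^ k : ℕ) : ℤ) • (a : W.galH1) = 0 := by
      rw [natCast_zsmul, ← AddSubgroupClass.coe_nsmul, hk, ZeroMemClass.coe_zero]
    have h := two_pow_M0_smul_eq_zero_of_mem_sha_rat_signFree hQ2 W hcm hT v h2v hNv hmult K hIQ hodd h3 hHe hsq1 hsq2 hρ Dt β ι d₁ M₀ hndiv hw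
      k a a.2 hka
    exact Subtype.ext (by rw [AddSubgroupClass.coe_nsmul, ZeroMemClass.coe_zero, ← natCast_zsmul]; exact h)
  exact ⟨finite_primaryComponent_sha_of_exponent W hexp, (natCard_selmerGroup_two_pow_eq_natCard_primaryComponent W hrk0 h2t hm hexp).symm⟩

/-- ★ **K4Pos's CONCLUSION ⟺ `#Sel_(2^M₀)(E/ℚ) ≠ #Sel_(2^(M₀−1))(E/ℚ)`** — on K4Pos's frame restricted to the cut (non-CM, `r_an = 0`, `ρ_{E,2^n}`
onto, odd Tamagawa, `Δ > 0`, an odd multiplicative prime `v`; `K` frame with the two B₂ non-squares; `d₁` with `P(1)` of infinite order,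
`2^(M₀) ∥ P(1)`, `M₀ ≥ 1`; a globally minimal twin `Wd ≅ E^(d_K)` with `#Sel₂(Wd) = 2`, `ord₂ C(Wd) = 0`), modulo Q2 and GZK: **(∃ square-free `n`,
a datum `d`, every `ℓ ∣ n` a Zhang–Kolyvagin prime at `2` of index `≥ 2` with a Frobenius moving a point of `E[2]`, `P(n) ∉ 2E(K[n])) ⟺ the
`2^(M₀)`-Selmer group of `E/ℚ` is STRICTLY LARGER than the `2^(M₀−1)`-Selmer group**.  g36's «B₂ sharp» currency
(`kFourPos_shape_iff_exists_mem_sha_two_pow_pred_smul_ne_zero`) + B₂ (`2^(M₀) · Ш(E/ℚ)[2^∞] = 0`) + §1 (`#Sel_(2^j) = #Ш[2^j]`).  No structure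
theorem, no pairing, no bound on `#Sel₂(E)`.  BSD is NOT proved by this; neither side is proved here.
[cite: Kolyvagin1989Izv, Thm. B₂] [cite: McCallumLMS1991, §5 Thm. 5.4, Cor. 5.6] [cite: SilvermanAEC2009, Thm. X.4.2] -/
theorem kFourPos_shape_iff_natCard_selmerGroup_ne (hQ2 : KolyvaginRelationAtTwo) (hGZK : MultPublishedInputsAtTwo)
    (W : WeierstrassCurve ℚ) [W.IsElliptic] [W.IsGloballyMinimal] [NeZero (W.conductorNorm ℤ)] (hcm : ¬ W.HasCM) (hr0 : W.analyticRank = 0)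
    (hρ : ∀ n : ℕ, 0 < n → W.HasSurjectiveModNGaloisRep ((2 : ℤ) ^ n)) (hT : Odd W.tamagawaProduct) (hΔ : 0 < W.Δ)
    (v : HeightOneSpectrum (𝓞 ℚ)) (h2v : ((2 : ℕ) : 𝓞 ℚ) ∉ v.asIdeal) (hNv : ((W.conductorNorm ℤ : ℕ) : 𝓞 ℚ) ∈ v.asIdeal)
    (hmult : W.HasMultiplicativeReductionAt v)
    (K : Type) [Field K] [NumberField K] (hIQ : IsImaginaryQuadratic K) (hodd : Odd (NumberField.discr K))
    (h3 : NumberField.discr K ≠ -3) (hHe : SatisfiesHeegnerHypothesis (W.conductorNorm ℤ) K)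
    (hsq1 : ¬ IsSquare ((NumberField.discr K : ℚ) * -|W.Δ|)) (hsq2 : ¬ IsSquare ((NumberField.discr K : ℚ) * (-(2 * |W.Δ|))))
    (Dt : ModularParametrizationData W (W.conductorNorm ℤ)) (β : ℤ) (ι : K →+* ℂ) (d₁ : KolyvaginHeegnerData Dt β ι 1)
    (hy : ¬ IsOfFinAddOrder d₁.derivedPoint) (M₀ : ℕ) (hM₀ : 1 ≤ M₀)
    (hdiv : ∃ Q : (W.baseChange (ringClassField K ι 1)).toAffine.Point, ((2 ^ M₀ : ℕ) : ℤ) • Q = d₁.derivedPoint)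
    (hndiv : ¬ ∃ Q : (W.baseChange (ringClassField K ι 1)).toAffine.Point, ((2 ^ (M₀ + 1) : ℕ) : ℤ) • Q = d₁.derivedPoint)
    (Wd : WeierstrassCurve ℚ) [Wd.IsElliptic] [Wd.IsGloballyMinimal]
    (hWd : ∃ C : VariableChange ℚ, C • W.quadraticTwist (NumberField.discr K : ℚ) = Wd)
    (hSel : Nat.card (Wd.selmerGroup 2) = 2) (hTam : padicValNat 2 Wd.tamagawaProduct = 0) :
    (∃ (n : ℕ) (d : KolyvaginHeegnerData Dt β ι n), Squarefree n ∧
      (∀ ℓ ∈ n.primeFactors, Zhang2014.IsKolyvaginPrime (W.conductorNorm ℤ) W K 2 ℓ ∧ 2 ≤ Zhang2014.kolyvaginIndex W 2 ℓ ∧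
        ∃ (v : HeightOneSpectrum (𝓞 ℚ)) (𝔓 : Ideal (absIntegers (𝓞 ℚ) ℚ)) (h : absoluteGaloisGroup ℚ),
          ((ℓ : ℕ) : 𝓞 ℚ) ∈ v.asIdeal ∧ 𝔓 ∈ v.primesAbove ∧ IsArithFrobAt (𝓞 ℚ) h 𝔓 ∧ ∃ u : W.geomTorsion ((2 : ℕ) : ℤ), h • u ≠ u) ∧
      ¬ ∃ Q : (W.baseChange (ringClassField K ι n)).toAffine.Point, (2 : ℤ) • Q = d.derivedPoint) ↔
    Nat.card (W.selmerGroup ((2 ^ M₀ : ℕ) : ℤ)) ≠ Nat.card (W.selmerGroup ((2 ^ (M₀ - 1) : ℕ) : ℤ)) := by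
  have hs2 : W.HasSurjectiveModNGaloisRep 2 := by simpa using hρ 1 one_pos
  have hw : W.rootNumber = 1 :=
    (Literature.Barriers.BirchSwinnertonDyer.even_analyticRank_iff_of_isNewformOf_conductorLevel Dt.isNewformOf).mp
      (by rw [hr0]; exact Even.zero)
  have hrk0 : W.mordellWeilRank = 0 := by rw [(hGZK W (by rw [hr0]; exact zero_le_one)).1, hr0]
  -- `E(ℚ)[2] = 0` (`convert` bridges the decidable-equality instance on `E(ℚ)` used by the general-`F` lemmas of §1)
  have h2t := forall_eq_zero_of_two_zsmul_eq_zero_of_natCard_torsionBy_two_eq_one W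
    (by convert natCard_torsionBy_point_two_eq_one_of_hasSurjectiveModNGaloisRep_two W hs2)
  rw [kFourPos_shape_iff_exists_mem_sha_two_pow_pred_smul_ne_zero hQ2 hGZK W hcm hr0 hρ hT hΔ v h2v hNv hmult K hIQ hodd h3 hHe hsq1 hsq2 Dt β ι
    d₁ hy M₀ hM₀ hdiv hndiv Wd hWd hSel hTam, ← exists_mem_sha_two_pow_smul_ne_zero_iff_natCard_selmerGroup_ne W hrk0 h2t hM₀]
  constructor
  · rintro ⟨k, a, ha, hka, hne⟩
    -- B₂: `2^(M₀) • a = 0`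
    exact ⟨a, ha, two_pow_M0_smul_eq_zero_of_mem_sha_rat_signFree hQ2 W hcm hT v h2v hNv hmult K hIQ hodd h3 hHe hsq1 hsq2 hρ Dt β ι d₁ M₀
      hndiv hw k a ha hka, hne⟩
  · rintro ⟨a, ha, hka, hne⟩
    exact ⟨M₀, a, ha, hka, hne⟩

/-- **THE CERTIFICATE DIRECTION ALONE (mod Q2 + GZK): `#Sel_(2^M₀)(E/ℚ) ≠ #Sel_(2^(M₀−1))(E/ℚ)` ⟹ K4Pos's conclusion** on the cut frame — no
twin, no sign of `Δ`, no `#Sel₂(E)` hypothesis: the inequality of counts is a class of `Ш(E/ℚ)[2^(M₀)]` not killed by `2^(M₀−1)` (§1), and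
B2Q♭ (`kFourPos_shape_of_mem_sha_rat_of_two_pow_pred_smul_ne_zero`) turns it into the witness.  At depth two: `#Sel₄(E/ℚ) ≠ #Sel₂(E/ℚ)` suffices.
BSD / K4Pos are NOT proved by this. [cite: McCallumLMS1991, §5 Thm. 5.4] [cite: Kolyvagin1989Izv, Thm. B₂] [cite: SilvermanAEC2009, Thm. X.4.2] -/
theorem kFourPos_shape_of_natCard_selmerGroup_ne (hQ2 : KolyvaginRelationAtTwo) (hGZK : MultPublishedInputsAtTwo)
    (W : WeierstrassCurve ℚ) [W.IsElliptic] [W.IsGloballyMinimal] [NeZero (W.conductorNorm ℤ)] (hcm : ¬ W.HasCM) (hr0 : W.analyticRank = 0)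
    (hρ : ∀ n : ℕ, 0 < n → W.HasSurjectiveModNGaloisRep ((2 : ℤ) ^ n)) (hT : Odd W.tamagawaProduct)
    (v : HeightOneSpectrum (𝓞 ℚ)) (h2v : ((2 : ℕ) : 𝓞 ℚ) ∉ v.asIdeal) (hNv : ((W.conductorNorm ℤ : ℕ) : 𝓞 ℚ) ∈ v.asIdeal)
    (hmult : W.HasMultiplicativeReductionAt v)
    (K : Type) [Field K] [NumberField K] (hIQ : IsImaginaryQuadratic K) (hodd : Odd (NumberField.discr K))
    (h3 : NumberField.discr K ≠ -3) (hHe : SatisfiesHeegnerHypothesis (W.conductorNorm ℤ) K)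
    (hsq1 : ¬ IsSquare ((NumberField.discr K : ℚ) * -|W.Δ|)) (hsq2 : ¬ IsSquare ((NumberField.discr K : ℚ) * (-(2 * |W.Δ|))))
    (Dt : ModularParametrizationData W (W.conductorNorm ℤ)) (β : ℤ) (ι : K →+* ℂ) (d₁ : KolyvaginHeegnerData Dt β ι 1) (M₀ : ℕ) (hM₀ : 1 ≤ M₀)
    (hndiv : ¬ ∃ Q : (W.baseChange (ringClassField K ι 1)).toAffine.Point, ((2 ^ (M₀ + 1) : ℕ) : ℤ) • Q = d₁.derivedPoint)
    (hne : Nat.card (W.selmerGroup ((2 ^ M₀ : ℕ) : ℤ)) ≠ Nat.card (W.selmerGroup ((2 ^ (M₀ - 1) : ℕ) : ℤ))) :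
    ∃ (n : ℕ) (d : KolyvaginHeegnerData Dt β ι n), Squarefree n ∧
      (∀ ℓ ∈ n.primeFactors, Zhang2014.IsKolyvaginPrime (W.conductorNorm ℤ) W K 2 ℓ ∧ 2 ≤ Zhang2014.kolyvaginIndex W 2 ℓ ∧
        ∃ (v : HeightOneSpectrum (𝓞 ℚ)) (𝔓 : Ideal (absIntegers (𝓞 ℚ) ℚ)) (h : absoluteGaloisGroup ℚ),
          ((ℓ : ℕ) : 𝓞 ℚ) ∈ v.asIdeal ∧ 𝔓 ∈ v.primesAbove ∧ IsArithFrobAt (𝓞 ℚ) h 𝔓 ∧ ∃ u : W.geomTorsion ((2 : ℕ) : ℤ), h • u ≠ u) ∧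
      ¬ ∃ Q : (W.baseChange (ringClassField K ι n)).toAffine.Point, (2 : ℤ) • Q = d.derivedPoint := by
  have hs2 : W.HasSurjectiveModNGaloisRep 2 := by simpa using hρ 1 one_pos
  have hw : W.rootNumber = 1 :=
    (Literature.Barriers.BirchSwinnertonDyer.even_analyticRank_iff_of_isNewformOf_conductorLevel Dt.isNewformOf).mp
      (by rw [hr0]; exact Even.zero)
  have hrk0 : W.mordellWeilRank = 0 := by rw [(hGZK W (by rw [hr0]; exact zero_le_one)).1, hr0]
  -- `E(ℚ)[2] = 0` (`convert` bridges the decidable-equality instance on `E(ℚ)` used by the general-`F` lemmas of §1)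
  have h2t := forall_eq_zero_of_two_zsmul_eq_zero_of_natCard_torsionBy_two_eq_one W
    (by convert natCard_torsionBy_point_two_eq_one_of_hasSurjectiveModNGaloisRep_two W hs2)
  obtain ⟨a, ha, hka, hne'⟩ := (exists_mem_sha_two_pow_smul_ne_zero_iff_natCard_selmerGroup_ne W hrk0 h2t hM₀).mpr hne
  exact kFourPos_shape_of_mem_sha_rat_of_two_pow_pred_smul_ne_zero hQ2 W hcm hT v h2v hNv hmult K hIQ hodd h3 hHe hsq1 hsq2 hρ Dt β ι d₁ M₀
    hndiv hw M₀ a ha hka hne'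

/-- **DEPTH TWO: K4Pos's conclusion ⟺ `#Sel₄(E/ℚ) ≠ 4`** on the `M₀ = 2` sub-cell of K4Pos's cut frame (where `#Sel₂(E/ℚ) = 4`), modulo Q2 and
GZK — the per-curve test BSD predicts to pass on every WALL-row-1 census cell with `16 ∥ #Ш_an(E)` is ONE `4`-descent count over `ℚ`.  BSD /
K4Pos are NOT proved by this. [cite: Kolyvagin1989Izv, Thm. B₂] [cite: McCallumLMS1991, §5 Thm. 5.4] [cite: SilvermanAEC2009, Thm. X.4.2] -/
theorem kFourPos_shape_iff_natCard_selmerGroup_four_ne_four_of_depth_two (hQ2 : KolyvaginRelationAtTwo) (hGZK : MultPublishedInputsAtTwo)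
    (W : WeierstrassCurve ℚ) [W.IsElliptic] [W.IsGloballyMinimal] [NeZero (W.conductorNorm ℤ)] (hcm : ¬ W.HasCM) (hr0 : W.analyticRank = 0)
    (hρ : ∀ n : ℕ, 0 < n → W.HasSurjectiveModNGaloisRep ((2 : ℤ) ^ n)) (hT : Odd W.tamagawaProduct) (hΔ : 0 < W.Δ)
    (hSel4 : Nat.card (W.selmerGroup 2) = 4)
    (v : HeightOneSpectrum (𝓞 ℚ)) (h2v : ((2 : ℕ) : 𝓞 ℚ) ∉ v.asIdeal) (hNv : ((W.conductorNorm ℤ : ℕ) : 𝓞 ℚ) ∈ v.asIdeal)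
    (hmult : W.HasMultiplicativeReductionAt v)
    (K : Type) [Field K] [NumberField K] (hIQ : IsImaginaryQuadratic K) (hodd : Odd (NumberField.discr K))
    (h3 : NumberField.discr K ≠ -3) (hHe : SatisfiesHeegnerHypothesis (W.conductorNorm ℤ) K)
    (hsq1 : ¬ IsSquare ((NumberField.discr K : ℚ) * -|W.Δ|)) (hsq2 : ¬ IsSquare ((NumberField.discr K : ℚ) * (-(2 * |W.Δ|))))
    (Dt : ModularParametrizationData W (W.conductorNorm ℤ)) (β : ℤ) (ι : K →+* ℂ) (d₁ : KolyvaginHeegnerData Dt β ι 1)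
    (hy : ¬ IsOfFinAddOrder d₁.derivedPoint)
    (hdiv : ∃ Q : (W.baseChange (ringClassField K ι 1)).toAffine.Point, ((2 ^ 2 : ℕ) : ℤ) • Q = d₁.derivedPoint)
    (hndiv : ¬ ∃ Q : (W.baseChange (ringClassField K ι 1)).toAffine.Point, ((2 ^ (2 + 1) : ℕ) : ℤ) • Q = d₁.derivedPoint)
    (Wd : WeierstrassCurve ℚ) [Wd.IsElliptic] [Wd.IsGloballyMinimal]
    (hWd : ∃ C : VariableChange ℚ, C • W.quadraticTwist (NumberField.discr K : ℚ) = Wd)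
    (hSel : Nat.card (Wd.selmerGroup 2) = 2) (hTam : padicValNat 2 Wd.tamagawaProduct = 0) :
    (∃ (n : ℕ) (d : KolyvaginHeegnerData Dt β ι n), Squarefree n ∧
      (∀ ℓ ∈ n.primeFactors, Zhang2014.IsKolyvaginPrime (W.conductorNorm ℤ) W K 2 ℓ ∧ 2 ≤ Zhang2014.kolyvaginIndex W 2 ℓ ∧
        ∃ (v : HeightOneSpectrum (𝓞 ℚ)) (𝔓 : Ideal (absIntegers (𝓞 ℚ) ℚ)) (h : absoluteGaloisGroup ℚ),
          ((ℓ : ℕ) : 𝓞 ℚ) ∈ v.asIdeal ∧ 𝔓 ∈ v.primesAbove ∧ IsArithFrobAt (𝓞 ℚ) h 𝔓 ∧ ∃ u : W.geomTorsion ((2 : ℕ) : ℤ), h • u ≠ u) ∧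
      ¬ ∃ Q : (W.baseChange (ringClassField K ι n)).toAffine.Point, (2 : ℤ) • Q = d.derivedPoint) ↔
    Nat.card (W.selmerGroup 4) ≠ 4 := by
  have h := kFourPos_shape_iff_natCard_selmerGroup_ne hQ2 hGZK W hcm hr0 hρ hT hΔ v h2v hNv hmult K hIQ hodd h3 hHe hsq1 hsq2 Dt β ι d₁ hy 2
    (by norm_num) hdiv hndiv Wd hWd hSel hTam
  have e4 : ((2 ^ 2 : ℕ) : ℤ) = 4 := by norm_num
  have e2 : ((2 ^ (2 - 1) : ℕ) : ℤ) = 2 := by norm_num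
  rw [e4, e2, hSel4] at h
  exact h

end Frame

end Summit.BirchSwinnertonDyer.BirchSwinnertonDyer.Theorems.GenusExact.PlusDescent

end
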